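import Literature.NumberTheory.Automorphic.WeilFamilyOfCoherentTorusDatum     -- ★ (W4b): `exists_centralizerMeasure_quotientMeasure_univ_eq_one`, and ★ (W4a) behind it
import HarnessLib

/-!
# The Weil-form orbital measure family of a coherent torus datum read through a bicontinuous isomorphism — WITH THE PULL-BACK DATUM EXPORTED
# («(W4b′)», generic; Rogawski 1990 §1.7 «compatible measures», §4.3 (4.3.1), Prop. 10.1.2 (b); Deitmar–Echterhoff Thm. 1.5.3)

Topic `NumberTheory/Automorphic`; namespace `Literature.NumberTheory.Automorphic` (generic: two locally compact second countable Hausdorff groups `B`, `A` and a bicontinuous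
`ψ : B ≃* A`).  THEOREMS ONLY (no `def`, no instance, no notation, no axiom, no named fact, no `sorry`).  Cell `pub/hodgecm-mathlib`, ENGINE T1 (crux H413 =
`stmt-HodgeConjecture-24833`); the (ST-∞) witness road, brick (W4b′) (F0P3-p03 (g11), SPEC (W4f) of F0P3a-p07 (g9) route (4a); LEAD F0P3a-plan (g10) WORD T9-22 (3)):
★ (W4b) `exists_isQuotientOf_of_coherent_torusDatum` — SUPERSEDE-NOT-EDIT twin — with ONE more conjunct exported: on the `P ∘ ψ`-points the datum `T′` IS the pull-back
`(ψ⁻¹|_{Z(ψ b)})_* T (ψ b)`.  This is the identity through which the universal pin ratio (U) (★ F0P3-p03 (g10) `smul_centralizerTopFormHaar_of_universal_pinRatio`) on the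
diagonal carrier reaches the datum of the family DEFINED on the inner form ((W4f): (J-val-K) for the built witness).  Count-neutral; HONEST LABEL: HC_CM is proved only modulo
the printed citations until rung 0 closes; nothing here bears on a summit statement.

WHAT.  **`exists_isQuotientOf_of_coherent_torusDatum_pullback`** — data as in ★ (W4b): `ψ : B ≃* A` bicontinuous; two-sided Haar measures `ν′` on `B`, `ν = ψ_* ν′` on `A`; a
conjugation-stable predicate `P` on `A`; a torus datum `T` on `A`, Haar ∕ inversion-invariant and conjugation-coherent on `P`; a predicate `Cen` of central elements of `B` off
`P ∘ ψ`.  THERE ARE a family `m′` on `B` and a datum `T′` with (i) `m′` IS the Weil quotient of `ν′` by `T′` on the `P ∘ ψ ∨ Cen`-classes (★ `IsQuotientOf`); (ii) `m′` is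
`B`-invariant at every class; (iii) mass one at every `Cen`-point [Prop. 10.1.2 (b)]; (iv) `(ψ_* m′).atPoint a = dν ∕ dT_a` at every `P`-point `a`; and — NEW — (v) at every
`b` with `P (ψ b)`, `T′ b = (ψ⁻¹|_{Z(ψ b)})_* T (ψ b)` (★ (W4a) `subgroupCongrHomeomorph ψ.symm`).  Proof = ★ (W4b)'s, the datum being DEFINED as this pull-back on `P ∘ ψ`.

## References
* [Rogawski1990] J. D. Rogawski, *Automorphic Representations of Unitary Groups in Three Variables*, Ann. of Math. Stud. 123 (1990), §1.7 p. 6; §4.3 (4.3.1) p. 43; Prop. 10.1.2 (b)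
  p. 146; §14.5 pp. 237–239.
* [DeitmarEchterhoff2014] A. Deitmar, S. Echterhoff, *Principles of Harmonic Analysis*, 2nd ed. (2014), Thm. 1.5.3.
* [Folland1995] G. B. Folland, *A Course in Abstract Harmonic Analysis* (1995), §2.6 (2.52).
-/

set_option autoImplicit false

noncomputable section

open MeasureTheory Measure Set TopologicalSpace
open Literature.MeasureTheory.Group Literature.NumberTheory.Rogawski1990

namespace Literature.NumberTheory.Automorphic

section WitnessPullback

variable {A B : Type*} [Group A] [Group B] [TopologicalSpace A] [TopologicalSpace B]
  [IsTopologicalGroup A] [IsTopologicalGroup B] [LocallyCompactSpace A] [LocallyCompactSpace B]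
  [SecondCountableTopology A] [SecondCountableTopology B] [T2Space A] [T2Space B]
  [MeasurableSpace A] [BorelSpace A] [MeasurableSpace B] [BorelSpace B]
  [∀ a : A, MeasurableSpace (A ⧸ Subgroup.centralizer ({a} : Set A))] [∀ a : A, BorelSpace (A ⧸ Subgroup.centralizer ({a} : Set A))]
  [∀ b : B, MeasurableSpace (B ⧸ Subgroup.centralizer ({b} : Set B))] [∀ b : B, BorelSpace (B ⧸ Subgroup.centralizer ({b} : Set B))]
  (ψ : B ≃* A) (hψ : Continuous ψ) (hψs : Continuous ψ.symm)
  (ν' : Measure B) [ν'.IsHaarMeasure] [ν'.IsMulRightInvariant] (ν : Measure A) [ν.IsHaarMeasure] [ν.IsMulRightInvariant] (hν : ν = Measure.map ψ ν')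
  {P : A → Prop} (hP : ∀ (a q : A), P a → P (q * a * q⁻¹))
  {Cen : B → Prop} (hCen : ∀ b : B, Cen b → ∀ g : B, g * b = b * g) (hCenP : ∀ b : B, Cen b → ¬ P (ψ b))
  (T : ∀ a : A, Measure (Subgroup.centralizer ({a} : Set A)))
  (hTi : ∀ a : A, P a → (T a).IsHaarMeasure ∧ (T a).IsInvInvariant)
  (hcoh : ∀ (a₁ a₂ q : A) (hq : (MulAut.conj q : A ≃* A) a₁ = a₂), P a₁ →
    Measure.map (subgroupCongrHomeomorph (MulAut.conj q : A ≃* A) (Subgroup.centralizer ({a₁} : Set A)) (Subgroup.centralizer ({a₂} : Set A))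
      (forall_apply_mem_centralizer_singleton_iff_of_eq (MulAut.conj q : A ≃* A) hq) (continuous_mulAutConj q) (continuous_mulAutConj_symm q)) (T a₁) = T a₂)

include hν hP hCen hCenP hTi hcoh in
/-- **(W4b′) THE WEIL FAMILY OF A COHERENT TORUS DATUM, READ THROUGH `ψ`, WITH PROBABILITY ONE-POINT ORBIT SPACES AT THE CENTRE — AND ITS DATUM EXPORTED AS THE PULL-BACK.**
For `ψ : B ≃* A` bicontinuous, two-sided Haar measures `ν′` on `B` and `ν = ψ_* ν′` on `A`, a conjugation-stable predicate `P` on `A`, a predicate `Cen` of central elements of `B` that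
are not `P`-points through `ψ`, and a torus datum `T` on `A` that is Haar, inversion-invariant and conjugation-coherent on `P`, THERE ARE a family `m′` on `B` and a datum `T′` such
that: (i) `m′` IS the Weil quotient `dν′ ∕ dT′` on the classes of `B` that are `P`-classes through `ψ` or `Cen` (★ `IsQuotientOf`); (ii) `m′` is `B`-invariant at every class;
(iii) at every `Cen`-point `b` the one-point orbit space has `m′.atPoint b`-mass `1` («`Φ(ζ, f) = f(ζ)`», ★ (W4b) §1); (iv) at every `P`-point `a`,
`(ψ_* m′).atPoint a = dν ∕ dT_a` (★ (W4a) §4); (v) at every `b` with `P (ψ b)`, `T′ b` IS the pull-back `(ψ⁻¹|_{Z(ψ b)})_* T (ψ b)` — so that an identity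
`T = K • T₀` on the `P`-points of `A` descends to `T′` on the `P ∘ ψ`-points of `B` («compatible measures», §1.7).
[cite: Rogawski1990, §1.7 p. 6; §4.3 (4.3.1) p. 43; Prop. 10.1.2 (b) p. 146; §14.5 pp. 238–239] [cite: DeitmarEchterhoff2014, Thm. 1.5.3] -/
theorem exists_isQuotientOf_of_coherent_torusDatum_pullback :
    ∃ (m' : OrbitalMeasureFamily B) (T' : ∀ b : B, Measure (Subgroup.centralizer ({b} : Set B))),
      m'.IsQuotientOf (fun b => P (ψ b) ∨ Cen b) ν' T' ∧
      (∀ c : ConjClasses B, SMulInvariantMeasure B (B ⧸ Subgroup.centralizer ({(Quotient.out c : B)} : Set B)) (m' c)) ∧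
      (∀ b : B, Cen b → m'.atPoint b Set.univ = 1) ∧
      (∀ a : A, P a → ∃ (_ : (T a).IsHaarMeasure) (_ : (T a).IsInvInvariant),
        (m'.transport ψ hψ hψs).atPoint a = quotientMeasure (Subgroup.centralizer ({a} : Set A)) (T a) (isClosed_coe_centralizer_singleton a) ν) ∧
      (∀ b : B, P (ψ b) → T' b =
        (T (ψ b)).map (subgroupCongrHomeomorph ψ.symm (Subgroup.centralizer ({ψ b} : Set A)) (Subgroup.centralizer ({b} : Set B))
          (forall_apply_mem_centralizer_singleton_iff_of_eq ψ.symm (ψ.symm_apply_apply b)) hψs hψ)) := by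
  classical
  -- ★ (W4b) §1's central data
  have hcen : ∀ b : B, (∀ g : B, g * b = b * g) → ∃ (ρ : Measure (Subgroup.centralizer ({b} : Set B))) (_ : ρ.IsHaarMeasure) (_ : ρ.IsInvInvariant),
      quotientMeasure (Subgroup.centralizer ({b} : Set B)) ρ (isClosed_coe_centralizer_singleton b) ν' Set.univ = 1 :=
    fun b hb => exists_centralizerMeasure_quotientMeasure_univ_eq_one ν' b hb
  -- the datum: pull-back of `T` through `ψ` on the `P ∘ ψ`-points, §1's datum at the centre, junk `0` elsewhere
  let T' : ∀ b : B, Measure (Subgroup.centralizer ({b} : Set B)) := fun b =>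
    if P (ψ b) then
      (T (ψ b)).map (subgroupCongrHomeomorph ψ.symm (Subgroup.centralizer ({ψ b} : Set A)) (Subgroup.centralizer ({b} : Set B))
        (forall_apply_mem_centralizer_singleton_iff_of_eq ψ.symm (ψ.symm_apply_apply b)) hψs hψ)
    else if hb : Cen b then (hcen b (hCen b hb)).choose else 0
  have hT'w : ∀ b : B, P (ψ b) → T' b =
      (T (ψ b)).map (subgroupCongrHomeomorph ψ.symm (Subgroup.centralizer ({ψ b} : Set A)) (Subgroup.centralizer ({b} : Set B))
        (forall_apply_mem_centralizer_singleton_iff_of_eq ψ.symm (ψ.symm_apply_apply b)) hψs hψ) := fun b h => by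
    simp only [T', if_pos h]
  have hT'c : ∀ (b : B) (hb : Cen b), ¬ P (ψ b) → T' b = (hcen b (hCen b hb)).choose := fun b hb h => by
    simp only [T', if_neg h, dif_pos hb]
  -- the datum is Haar ∕ inversion-invariant at the guarded points
  have hT'i : ∀ b : B, (P (ψ b) ∨ Cen b) → (T' b).IsHaarMeasure ∧ (T' b).IsInvInvariant := by
    intro b h
    by_cases hw : P (ψ b)
    · rw [hT'w b hw]
      haveI := (hTi _ hw).1
      haveI := (hTi _ hw).2
      exact ⟨isHaarMeasure_pullback ψ hψ hψs T b, isInvInvariant_pullback ψ hψ hψs T b⟩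
    · have hb : Cen b := h.resolve_left hw
      rw [hT'c b hb hw]
      exact ⟨(hcen b (hCen b hb)).choose_spec.choose, (hcen b (hCen b hb)).choose_spec.choose_spec.choose⟩
  -- the family (★ (W4a) §1)
  obtain ⟨m', hm', hinv, -⟩ := exists_orbitalMeasureFamily_isQuotientOf (fun b => P (ψ b) ∨ Cen b) ν' T' hT'i
  refine ⟨m', T', hm', hinv, fun b hb => ?_, fun a ha => ?_, hT'w⟩
  · -- (iii) the centre: `m′.atPoint b (univ) = m′ ⟦b⟧ (univ) = (dν′ ∕ dT′_{out ⟦b⟧})(pt) = 1`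
    have hout : (Quotient.out (ConjClasses.mk b) : B) = b := quotientOut_conjClassesMk_eq_of_forall_comm (hCen b hb)
    have h1 : m'.atPoint b Set.univ = m' (ConjClasses.mk b) Set.univ := by
      rw [OrbitalMeasureFamily.atPoint, Measure.map_apply (continuous_cosetCongr _ _ _ _ (continuous_mulAutConj _)).measurable MeasurableSet.univ,
        Set.preimage_univ]
    rw [h1]
    have hbo : Cen (Quotient.out (ConjClasses.mk b) : B) := by
      rw [hout]; exact hb
    obtain ⟨i1, i2, hq⟩ := hm' (ConjClasses.mk b) (Or.inr hbo)
    rw [hq]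
    have hTc := hT'c _ hbo (hCenP _ hbo)
    have key : ∀ (ρ : Measure (Subgroup.centralizer ({(Quotient.out (ConjClasses.mk b) : B)} : Set B))) (_ : ρ.IsHaarMeasure) (_ : ρ.IsInvInvariant),
        T' (Quotient.out (ConjClasses.mk b)) = ρ →
          quotientMeasure (Subgroup.centralizer ({(Quotient.out (ConjClasses.mk b) : B)} : Set B)) (T' (Quotient.out (ConjClasses.mk b)))
              (isClosed_coe_centralizer_singleton _) ν' =
            quotientMeasure (Subgroup.centralizer ({(Quotient.out (ConjClasses.mk b) : B)} : Set B)) ρ (isClosed_coe_centralizer_singleton _) ν' := by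
      intro ρ _ _ h
      subst h
      rfl
    rw [key _ (hcen _ (hCen _ hbo)).choose_spec.choose (hcen _ (hCen _ hbo)).choose_spec.choose_spec.choose hTc]
    exact (hcen _ (hCen _ hbo)).choose_spec.choose_spec.choose_spec
  · -- (iv) the wall points: ★ (W4a) §4 for `m′` restricted to `P ∘ ψ` with the pull-back datum
    have hmw : m'.IsQuotientOf (fun b => P (ψ b)) ν' (fun b => (T (ψ b)).map (subgroupCongrHomeomorph ψ.symm (Subgroup.centralizer ({ψ b} : Set A))
        (Subgroup.centralizer ({b} : Set B)) (forall_apply_mem_centralizer_singleton_iff_of_eq ψ.symm (ψ.symm_apply_apply b)) hψs hψ)) :=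
      hm'.of_imp_of_eq (fun c hc => Or.inl hc) (fun c hc => (hT'w _ hc).symm)
    exact hmw.atPoint_transport_eq_quotientMeasure_of_pullback ψ hψ hψs hP ν' ν hν T hcoh a ha

end WitnessPullback

end Literature.NumberTheory.Automorphic

end
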